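import Summits.HodgeConjecture.CorCM.Census.CoprimeCyclotomicProducts357
import Literature.AlgebraicGeometry.Pohlmann1968.DegenerateCMTypesRibetLenstraSerre
import Literature.AlgebraicGeometry.Pohlmann1968.NondegenerateCMTypeDivisorClasses
import Literature.AlgebraicGeometry.ComplexMultiplication.SimpleIffPrimitiveCMType
import HarnessLib

/-!
# Census `E^a × S^b × T^c` over `ℚ(ζ₃)`, `ℚ(ζ₅)`, `ℚ(ζ₇)` for EVERY CM structure: all CM types of `ℚ(ζ₃)`, `ℚ(i)`,
# `ℚ(ζ₅)` are primitive and nondegenerate, a CM type of `ℚ(ζ₇)` is nondegenerate iff primitive iff its realisation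
# is simple, and the Hodge conjecture holds on every product of an elliptic curve with CM by `ℤ[ζ₃]`, an abelian
# surface with CM by `ℤ[ζ₅]` and a SIMPLE abelian threefold with CM by `ℤ[ζ₇]`

COR-CM (cell `pub-hodgecm2`), seat b27 (2026-08-21), count-neutral sequel to the census
`Census.CoprimeCyclotomicProducts357` (literature seat `lit-deligne-3` gen 4), answering its sized ask "enumerate ALL CM
types of `ℚ(ζ₅)` / `ℚ(ζ₃)` / `ℚ(ζ₄)` as nondegenerate, so the census holds for every CM structure on those fields, not
only the listed residue types".  Everything is PROVED (no named fact, no `sorry`, no new definition).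

THE CENSUS of `CoprimeCyclotomicProducts357` fixes one CM type per slot (`S_3 = {1}`, `S_5 = {1,2}`, `S_7 = {1,2,3}`).
Here the types are ARBITRARY:

* §1 (generic level `N`) **every CM type of an `N`-th cyclotomic field is cut out by a set of residues**,
  `Φ = Cyclotomic.cmTypeOfResidues S hS`, `S ⊆ (ℤ/N)ˣ` (`exists_eq_cmTypeOfResidues`: `σ ↦ e(σ)`, `σ ζ_N = e^{2πi e(σ)/N}`,
  is a bijection `Hom(ℚ(ζ_N), ℂ) ≅ (ℤ/N)ˣ`, Washington Thm. 2.5), so a property of residue sets decided on the finite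
  set `(ℤ/N)ˣ` transports to ALL CM types (`isPrimitive_of_forall_separating`);
* §2 (levels `3, 4, 5`) every CM residue set of `(ℤ/3)ˣ`, `(ℤ/4)ˣ`, `(ℤ/5)ˣ` has separating translates (`decide`),
  hence **every CM type of `ℚ(ζ₃) = ℚ(√-3)`, `ℚ(ζ₄) = ℚ(i)`, `ℚ(ζ₅)` is primitive and nondegenerate** (Shimura §8.2
  Prop. 26; Ribet (3.7)), and every realisation is SIMPLE — these fields have no proper CM subfield;
* §3 (the three slots, degree `≤ 6`) **nondegenerate ⟺ primitive ⟺ the realisation is simple**; for `ℚ(ζ₇)` the two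
  imprimitive types are the `ℚ(√-7)`-induced ones (`Zeta7PrimitiveResidueTypes`: residue sets `{1,2,4}`, `{3,5,6}`);
* §4 **the census for every CM structure**: for ARBITRARY CM types `Ψ_3, Ψ_5, Ψ_7` of the three slots the family is
  nondegenerate iff `Ψ_7` is primitive iff the `ℚ(ζ₇)`-factor `T` is simple (`isNondegenerateFamily_iff_isSimple_seven`;
  coprime levels ⟹ additive rank), and then `Bᵐ ⊗ ℂ = Dᵐ ⊗ ℂ` and the Hodge conjecture hold on EVERY product
  `⨁_{j<M} A_{π j}` of realisations (**`hodgeConjectureFor_prod_of_isSimple`**): every `E^a × S^b × T^c`, any order,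
  with `E` ANY elliptic curve with CM by `ℤ[ζ₃]`, `S` ANY abelian surface with CM by `ℤ[ζ₅]`, `T` any SIMPLE abelian
  threefold with CM by `ℤ[ζ₇]` — and, with NO hypothesis at all, on every `E^a × S^b`
  (**`hodgeConjectureFor_prod_of_forall_ne_seven`**).

## References

* [Gordon1999HodgeAVSurvey] B. B. Gordon, *A survey of the Hodge conjecture for abelian varieties*, §3 Theorem, 7.5,
  §9.4.2, 10.10.
* [Ribet1980] K. Ribet, *Division fields of abelian varieties with complex multiplication*, §3 (3.7).
* [Kubota1965] T. Kubota, *On the field extension by complex multiplication*, §2, Lemma 2.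
* [Shimura1998] G. Shimura, *Abelian Varieties with Complex Multiplication and Modular Functions*, §6.2 Thm. 3,
  §8.2 Prop. 26.
* [Washington1997] L. C. Washington, *Introduction to Cyclotomic Fields*, Prop. 2.4, Thm. 2.5.
-/

noncomputable section

open CategoryTheory CategoryTheory.Limits NumberField

namespace Summit.HodgeConjecture.CorCM.Census.CoprimeCyclotomicProducts357

open Literature.NumberTheory.ComplexMultiplication
open Literature.AlgebraicGeometry.Motives (AbelianVariety CMType)
open Literature.AlgebraicGeometry.HodgeTheory
open Literature.AlgebraicGeometry.ComplexMultiplication (IsCMTypeRealisation isSimple_iff_isPrimitive)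
open Literature.AlgebraicGeometry.VanGeemen1994 (hodgeClassSpan)
open Literature.AlgebraicGeometry.Pohlmann1968
open Literature.AlgebraicGeometry.Pohlmann1968.Cyclotomic
open Literature.Barriers.HodgeConjecture (divisorClassesSpan)

namespace AllTypes

/-! ### §1 Generic level `N`: every CM type of `ℚ(ζ_N)` is a residue type -/

section Level

variable (N : ℕ) [NeZero N] (L : Type) [Field L] [NumberField L] [IsCyclotomicExtension {N} ℚ L]

/-- **Every CM type of an `N`-th cyclotomic field is cut out by a set of residues**: `Φ = Φ_S` with
`S = {e(σ) | σ ∈ Φ} ⊆ (ℤ/N)ˣ` a set of representatives of `(ℤ/N)ˣ/{±1}` — `σ ↦ e(σ)` is a bijection of `Hom(ℚ(ζ_N), ℂ)`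
onto the units and `e(σ̄) = −e(σ)`. [cite: Washington1997, Thm. 2.5] [cite: Gordon1999HodgeAVSurvey, §9.4.2] -/
theorem exists_eq_cmTypeOfResidues (units : Finset (ZMod N)) (hunits : ∀ c : ZMod N, c.val.Coprime N ↔ c ∈ units)
    (Φ : CMType L) :
    ∃ S, S ⊆ units ∧ ∃ hS : (∀ c : ZMod N, c.val.Coprime N → (c ∈ S ↔ -c ∉ S)),
      Φ = cmTypeOfResidues (L := L) S hS := by
  classical
  set S : Finset (ZMod N) := units.filter fun c => ∃ σ : L →+* ℂ, σ ∈ Φ.1 ∧ expOf N L σ = c with hSdef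
  have hmem : ∀ σ : L →+* ℂ, expOf N L σ ∈ S ↔ σ ∈ Φ.1 := by
    intro σ
    rw [hSdef, Finset.mem_filter]
    constructor
    · rintro ⟨-, τ, hτ, hτσ⟩
      rwa [← expOf_injective N L hτσ]
    · intro h
      exact ⟨(hunits _).1 (coprime_expOf N L σ), σ, h, rfl⟩
  have hS : ∀ c : ZMod N, c.val.Coprime N → (c ∈ S ↔ -c ∉ S) := by
    intro c hc
    obtain ⟨σ, rfl⟩ := exists_expOf_eq N L c hc
    rw [hmem, ← expOf_conjugate, hmem]
    exact Φ.2 σ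
  refine ⟨S, Finset.filter_subset _ _, hS, Subtype.ext (Set.ext fun σ => ?_)⟩
  rw [mem_cmTypeOfResidues_iff, hmem]

/-- **Transport of primitivity to ALL CM types**: if EVERY CM residue set `S ⊆ (ℤ/N)ˣ` has separating translates (a
finite statement about `(ℤ/N)ˣ`), every CM type of `ℚ(ζ_N)` is primitive at every base embedding.
[cite: Shimura1998, §8.2 Prop. 26] [cite: Washington1997, Thm. 2.5] -/
theorem isPrimitive_of_forall_separating (units : Finset (ZMod N))
    (hunits : ∀ c : ZMod N, c.val.Coprime N ↔ c ∈ units)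
    (hsep : ∀ S ∈ units.powerset, (∀ c ∈ units, (c ∈ S ↔ -c ∉ S)) →
      ∀ a ∈ units, ∀ b ∈ units, (∀ u ∈ units, (u * a ∈ S ↔ u * b ∈ S)) → a = b)
    (Φ : CMType L) (φ₀ : L →+* ℂ) : IsPrimitive (ℂ ≃+* ℂ) Φ.1 φ₀ := by
  obtain ⟨S, hSu, hS, rfl⟩ := exists_eq_cmTypeOfResidues N L units hunits Φ
  exact isPrimitive_of_residues units hunits
    (hsep S (Finset.mem_powerset.2 hSu) fun c hc => hS c ((hunits c).2 hc)) φ₀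

/-- **Transport of simplicity**: under the same finite hypothesis every realisation of every CM type of `ℚ(ζ_N)` is a
SIMPLE abelian variety (Shimura §8.2 Prop. 26). [cite: Shimura1998, §8.2 Prop. 26] -/
theorem isSimple_of_forall_separating (units : Finset (ZMod N))
    (hunits : ∀ c : ZMod N, c.val.Coprime N ↔ c ∈ units)
    (hsep : ∀ S ∈ units.powerset, (∀ c ∈ units, (c ∈ S ↔ -c ∉ S)) →
      ∀ a ∈ units, ∀ b ∈ units, (∀ u ∈ units, (u * a ∈ S ↔ u * b ∈ S)) → a = b)
    (Φ : CMType L) {A : AbelianVariety ℂ} {ι : 𝓞 L →+* End A} {θ : L →+* Module.End ℂ (complexBetti A.X 1)}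
    (hA : IsCMTypeRealisation Φ A ι θ) : A.IsSimple := by
  obtain ⟨s₀⟩ := (inferInstance : Nonempty (L →+* ℂ))
  exact (isSimple_iff_isPrimitive hA s₀).2 (isPrimitive_of_forall_separating N L units hunits hsep Φ s₀)

omit [NeZero N] in
/-- **Degree `≤ 6`: nondegenerate ⟺ primitive** for a CM type of `ℚ(ζ_N)` with `φ(N) ≤ 6` (Kubota: nondegenerate ⟹
primitive; Ribet (3.7): primitive of degree `≤ 6` ⟹ nondegenerate). [cite: Ribet1980, §3 Examples (3.7) (p. 87)]
[cite: Kubota1965, §2 (p. 115)] -/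
theorem isNondegenerate_iff_isPrimitive_of_totient_le_six [NeZero N] (hN : 2 < N) (hφ : N.totient ≤ 6)
    (Φ : CMType L) (φ₀ : L →+* ℂ) : IsNondegenerate Φ ↔ IsPrimitive (ℂ ≃+* ℂ) Φ.1 φ₀ := by
  haveI : IsCMField L := IsCyclotomicExtension.Rat.isCMField L (S := {N}) ⟨N, rfl, hN⟩
  have hK : Module.finrank ℚ L ≤ 6 := by rw [finrank_eq_totient N L]; exact hφ
  exact ⟨fun h => h.isPrimitive φ₀, isNondegenerate_of_isPrimitive_of_finrank_le_six Φ hK φ₀⟩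

omit [NeZero N] in
/-- **Degree `≤ 6`: nondegenerate ⟺ the realisation is simple.** [cite: Ribet1980, §3 Examples (3.7) (p. 87)]
[cite: Shimura1998, §8.2 Prop. 26] -/
theorem isNondegenerate_iff_isSimple_of_totient_le_six [NeZero N] (hN : 2 < N) (hφ : N.totient ≤ 6)
    (Φ : CMType L) {A : AbelianVariety ℂ} {ι : 𝓞 L →+* End A} {θ : L →+* Module.End ℂ (complexBetti A.X 1)}
    (hA : IsCMTypeRealisation Φ A ι θ) : IsNondegenerate Φ ↔ A.IsSimple := by
  obtain ⟨s₀⟩ := (inferInstance : Nonempty (L →+* ℂ))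
  rw [isNondegenerate_iff_isPrimitive_of_totient_le_six N L hN hφ Φ s₀, isSimple_iff_isPrimitive hA s₀]

end Level

/-! ### §2 Levels `3, 4, 5`: every CM residue set is separating; all CM types are primitive and nondegenerate -/

set_option maxRecDepth 8192 in
set_option synthInstance.maxSize 2048 in
set_option synthInstance.maxHeartbeats 200000 in
/-- **Levels `3` and `5` (the slots `three`, `five` of the census): EVERY CM residue set of `(ℤ/3)ˣ`, `(ℤ/5)ˣ` has
separating translates** (decided over the subsets of the units: for `ℤ/5`, a stabiliser `t ≠ 1` of a CM set `S`
would give `t² = −1 ∈ Stab(S)`, contradicting `S ∩ −S = ∅`). [cite: Shimura1998, §8.2 Prop. 26] -/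
theorem separating_of_ne_seven : ∀ i : Slot, i ≠ .seven → ∀ S ∈ (units i).powerset,
    (∀ c ∈ units i, (c ∈ S ↔ -c ∉ S)) →
      ∀ a ∈ units i, ∀ b ∈ units i, (∀ u ∈ units i, (u * a ∈ S ↔ u * b ∈ S)) → a = b := by
  intro i
  cases i with
  | three => intro _; decide
  | five => intro _; decide
  | seven => intro h; exact absurd rfl h

/-- `c` is prime to `4` iff `c ∈ {1, 3} = (ℤ/4)ˣ`. [cite: Washington1997, Thm. 2.5] -/
theorem coprime_four_iff (c : ZMod 4) : c.val.Coprime 4 ↔ c ∈ ({1, 3} : Finset (ZMod 4)) := by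
  revert c; decide

set_option maxRecDepth 8192 in
set_option synthInstance.maxSize 2048 in
set_option synthInstance.maxHeartbeats 200000 in
/-- **Level `4`: every CM residue set of `(ℤ/4)ˣ = {±1}` (i.e. `{1}` or `{3}`) has separating translates.**
[cite: Shimura1998, §8.2 Prop. 26] -/
theorem separating_four : ∀ S ∈ ({1, 3} : Finset (ZMod 4)).powerset,
    (∀ c ∈ ({1, 3} : Finset (ZMod 4)), (c ∈ S ↔ -c ∉ S)) →
      ∀ a ∈ ({1, 3} : Finset (ZMod 4)), ∀ b ∈ ({1, 3} : Finset (ZMod 4)),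
        (∀ u ∈ ({1, 3} : Finset (ZMod 4)), (u * a ∈ S ↔ u * b ∈ S)) → a = b := by
  decide

section SmallLevels

variable (K : Slot → Type) [∀ i, Field (K i)] [∀ i, NumberField (K i)]
  [∀ i, IsCyclotomicExtension {level i} ℚ (K i)]

/-- **Every CM type of `ℚ(ζ₃)` and of `ℚ(ζ₅)` is primitive** (at every base embedding): these fields have no proper
CM subfield. [cite: Shimura1998, §8.2 Prop. 26] -/
theorem isPrimitive_of_ne_seven {i : Slot} (hi : i ≠ .seven) (Φ : CMType (K i)) (φ₀ : K i →+* ℂ) :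
    IsPrimitive (ℂ ≃+* ℂ) Φ.1 φ₀ :=
  isPrimitive_of_forall_separating (level i) (K i) (units i) (coprime_iff_mem_units i) (separating_of_ne_seven i hi)
    Φ φ₀

/-- **Every CM type of `ℚ(ζ₃)` and of `ℚ(ζ₅)` is nondegenerate** (Ribet: primitive of degree `≤ 6`; ranks `2`, `3`).
[cite: Ribet1980, §3 Examples (3.7) (p. 87)] -/
theorem isNondegenerate_of_ne_seven {i : Slot} (hi : i ≠ .seven) (Φ : CMType (K i)) : IsNondegenerate Φ := by
  haveI := isCMField_K K i
  obtain ⟨φ₀⟩ := (inferInstance : Nonempty (K i →+* ℂ))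
  exact isNondegenerate_of_isPrimitive_of_finrank_le_six Φ (finrank_le_six K i) φ₀ (isPrimitive_of_ne_seven K hi Φ φ₀)

variable {K} in
/-- **Every abelian variety with CM by `ℤ[ζ₃]` or `ℤ[ζ₅]` (a realisation of any CM type of `ℚ(ζ₃)`, `ℚ(ζ₅)`) is
SIMPLE** — a CM elliptic curve, resp. a simple CM abelian surface. [cite: Shimura1998, §8.2 Prop. 26] -/
theorem isSimple_of_ne_seven {i : Slot} (hi : i ≠ .seven) {Φ : CMType (K i)} {A : AbelianVariety ℂ}
    {ι : 𝓞 (K i) →+* End A} {θ : K i →+* Module.End ℂ (complexBetti A.X 1)} (hA : IsCMTypeRealisation Φ A ι θ) :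
    A.IsSimple :=
  isSimple_of_forall_separating (level i) (K i) (units i) (coprime_iff_mem_units i) (separating_of_ne_seven i hi) Φ hA

end SmallLevels

section Four

variable (L : Type) [Field L] [NumberField L] [IsCyclotomicExtension {4} ℚ L]

/-- **Every CM type of `ℚ(ζ₄) = ℚ(i)` is primitive.** [cite: Shimura1998, §8.2 Prop. 26] -/
theorem isPrimitive_four (Φ : CMType L) (φ₀ : L →+* ℂ) : IsPrimitive (ℂ ≃+* ℂ) Φ.1 φ₀ :=
  isPrimitive_of_forall_separating 4 L {1, 3} coprime_four_iff separating_four Φ φ₀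

/-- **Every CM type of `ℚ(ζ₄) = ℚ(i)` is nondegenerate** (rank `2`). [cite: Ribet1980, §3 Examples (3.7) (p. 87)] -/
theorem isNondegenerate_four (Φ : CMType L) : IsNondegenerate Φ := by
  obtain ⟨φ₀⟩ := (inferInstance : Nonempty (L →+* ℂ))
  exact (isNondegenerate_iff_isPrimitive_of_totient_le_six 4 L (by norm_num) (by decide) Φ φ₀).2
    (isPrimitive_four L Φ φ₀)

variable {L} in
/-- Every abelian variety with CM by `ℤ[i]` realising a CM type of `ℚ(i)` is simple (an elliptic curve).
[cite: Shimura1998, §8.2 Prop. 26] -/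
theorem isSimple_four {Φ : CMType L} {A : AbelianVariety ℂ} {ι : 𝓞 L →+* End A}
    {θ : L →+* Module.End ℂ (complexBetti A.X 1)} (hA : IsCMTypeRealisation Φ A ι θ) : A.IsSimple :=
  isSimple_of_forall_separating 4 L {1, 3} coprime_four_iff separating_four Φ hA

end Four

/-! ### §3 The three slots (degree `≤ 6`): nondegenerate ⟺ primitive ⟺ simple realisation -/

section Slots

variable (K : Slot → Type) [∀ i, Field (K i)] [∀ i, NumberField (K i)]
  [∀ i, IsCyclotomicExtension {level i} ℚ (K i)]

/-- `φ(N_i) ≤ 6` for the three levels. [cite: Washington1997, Thm. 2.5] -/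
theorem totient_level_le_six (i : Slot) : (level i).totient ≤ 6 := by cases i <;> decide

/-- **For a CM type of `ℚ(ζ₃)`, `ℚ(ζ₅)` or `ℚ(ζ₇)`: nondegenerate ⟺ primitive.** For `ℚ(ζ₇)` the imprimitive (=
degenerate) types are exactly the two `ℚ(√-7)`-induced ones (`Zeta7WeilFamily.eq_squares_or_of_not_separating`).
[cite: Ribet1980, §3 Examples (3.7) (p. 87)] [cite: Kubota1965, §2 (p. 115)] -/
theorem isNondegenerate_iff_isPrimitive (i : Slot) (Φ : CMType (K i)) (φ₀ : K i →+* ℂ) :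
    IsNondegenerate Φ ↔ IsPrimitive (ℂ ≃+* ℂ) Φ.1 φ₀ :=
  isNondegenerate_iff_isPrimitive_of_totient_le_six (level i) (K i) (two_lt_level i) (totient_level_le_six i) Φ φ₀

variable {K} in
/-- **For a CM type of `ℚ(ζ₃)`, `ℚ(ζ₅)` or `ℚ(ζ₇)`: nondegenerate ⟺ its realisation is simple** — in particular an
abelian threefold with CM by `ℤ[ζ₇]` is stably nondegenerate iff it is simple (iff it is not isogenous to the cube
of an elliptic curve with CM by `ℚ(√-7)`). [cite: Ribet1980, §3 Examples (3.7) (p. 87)]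
[cite: Shimura1998, §8.2 Prop. 26] -/
theorem isNondegenerate_iff_isSimple {i : Slot} (Φ : CMType (K i)) {A : AbelianVariety ℂ}
    {ι : 𝓞 (K i) →+* End A} {θ : K i →+* Module.End ℂ (complexBetti A.X 1)} (hA : IsCMTypeRealisation Φ A ι θ) :
    IsNondegenerate Φ ↔ A.IsSimple :=
  isNondegenerate_iff_isSimple_of_totient_le_six (level i) (K i) (two_lt_level i) (totient_level_le_six i) Φ hA

end Slots

/-! ### §4 The census for EVERY CM structure on the three slots -/

section Census

variable (K : Slot → Type) [∀ i, Field (K i)] [∀ i, NumberField (K i)]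
  [∀ i, IsCyclotomicExtension {level i} ℚ (K i)]
variable (Ψ : ∀ i, CMType (K i))

/-- **A family `(Ψ_3, Ψ_5, Ψ_7)` of ARBITRARY CM types of `ℚ(ζ₃)`, `ℚ(ζ₅)`, `ℚ(ζ₇)` is nondegenerate iff its
`ℚ(ζ₇)`-member is** (the levels are coprime, so `rank Y(MT(E × S × T)) = rank(Ψ_3) + rank(Ψ_5) + rank(Ψ_7) − 2` is
additive, and `Ψ_3, Ψ_5` are always nondegenerate). [cite: Gordon1999HodgeAVSurvey, §3 Theorem and 7.5]
[cite: Washington1997, Prop. 2.4] -/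
theorem isNondegenerateFamily_iff_isNondegenerate_seven :
    CMAlgebra.IsNondegenerateFamily Ψ ↔ IsNondegenerate (Ψ .seven) := by
  haveI : ∀ i, IsCMField (K i) := isCMField_K K
  rw [isNondegenerateFamily_iff_of_coprime_cyclotomic level level_coprime Ψ]
  refine ⟨fun h => h .seven, fun h7 i => ?_⟩
  by_cases hi : i = .seven
  · subst hi; exact h7
  · exact isNondegenerate_of_ne_seven K hi (Ψ i)

/-- **… iff `Ψ_7` is primitive** (at any base embedding). [cite: Gordon1999HodgeAVSurvey, §3 Theorem and 7.5]
[cite: Ribet1980, §3 Examples (3.7) (p. 87)] -/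
theorem isNondegenerateFamily_iff_isPrimitive_seven (φ₀ : K .seven →+* ℂ) :
    CMAlgebra.IsNondegenerateFamily Ψ ↔ IsPrimitive (ℂ ≃+* ℂ) (Ψ .seven).1 φ₀ := by
  rw [isNondegenerateFamily_iff_isNondegenerate_seven K Ψ, isNondegenerate_iff_isPrimitive K .seven (Ψ .seven) φ₀]

variable {K Ψ}
variable {A : Slot → AbelianVariety ℂ} {ι : ∀ i, 𝓞 (K i) →+* End (A i)}
  {θ : ∀ i, K i →+* Module.End ℂ (complexBetti (A i).X 1)}

/-- `dim A_i = φ(N_i)/2`: the realisations are an elliptic curve, an abelian surface and an abelian threefold,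
whatever the CM types. [cite: Shimura1998, §6.2 Theorem 3] -/
theorem dim_eq (hA : ∀ i, IsCMTypeRealisation (Ψ i) (A i) (ι i) (θ i)) :
    (A .three).dim = 1 ∧ (A .five).dim = 2 ∧ (A .seven).dim = 3 := by
  refine ⟨?_, ?_, ?_⟩
  · rw [Cyclotomic.dim_eq_of_realisation (N := level .three) (hA .three)]; decide
  · rw [Cyclotomic.dim_eq_of_realisation (N := level .five) (hA .five)]; decide
  · rw [Cyclotomic.dim_eq_of_realisation (N := level .seven) (hA .seven)]; decide

/-- The `ℚ(ζ₃)`- and `ℚ(ζ₅)`-factors are SIMPLE for every CM type: a CM elliptic curve and a simple CM abelian surface.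
[cite: Shimura1998, §8.2 Prop. 26] -/
theorem isSimple_three_five (hA : ∀ i, IsCMTypeRealisation (Ψ i) (A i) (ι i) (θ i)) :
    (A .three).IsSimple ∧ (A .five).IsSimple :=
  ⟨isSimple_of_ne_seven (by decide) (hA .three), isSimple_of_ne_seven (by decide) (hA .five)⟩

/-- **The family of realised types is nondegenerate iff the `ℚ(ζ₇)`-factor `T` is simple** (`E × S × T` is stably
nondegenerate ⟺ `T ≁ E'³`). [cite: Gordon1999HodgeAVSurvey, §3 Theorem and 7.5] [cite: Shimura1998, §8.2 Prop. 26] -/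
theorem isNondegenerateFamily_iff_isSimple_seven (hA : ∀ i, IsCMTypeRealisation (Ψ i) (A i) (ι i) (θ i)) :
    CMAlgebra.IsNondegenerateFamily Ψ ↔ (A .seven).IsSimple := by
  rw [isNondegenerateFamily_iff_isNondegenerate_seven K Ψ, isNondegenerate_iff_isSimple (Ψ .seven) (hA .seven)]

/-- **`Bᵐ ⊗ ℂ = Dᵐ ⊗ ℂ` on every product `⨁_{j<M} A_{π j}` — every `E^a × S^b × T^c`, any order of the factors — of an
elliptic curve with CM by `ℤ[ζ₃]`, an abelian surface with CM by `ℤ[ζ₅]` and a SIMPLE abelian threefold with CM by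
`ℤ[ζ₇]`, WHATEVER their CM types.** [cite: Gordon1999HodgeAVSurvey, §3 Theorem (2) and 7.5] -/
theorem hodgeClassSpan_prod_eq_divisorClassesSpan_of_isSimple (hA : ∀ i, IsCMTypeRealisation (Ψ i) (A i) (ι i) (θ i))
    (hT : (A .seven).IsSimple) {M : ℕ} (π : Fin M → Slot) (m : ℕ) :
    hodgeClassSpan (⨁ fun j : Fin M => A (π j)).dim (⨁ fun j : Fin M => A (π j)).X m =
      divisorClassesSpan (⨁ fun j : Fin M => A (π j)).X (⨁ fun j : Fin M => A (π j)).dim m := by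
  haveI : ∀ i, IsCMField (K i) := isCMField_K K
  exact hodgeClassSpan_prod_eq_divisorClassesSpan_of_coprime_cyclotomic level level_coprime
    ((isNondegenerateFamily_iff_of_coprime_cyclotomic level level_coprime Ψ).1
      ((isNondegenerateFamily_iff_isSimple_seven hA).2 hT)) hA π m

/-- **The Hodge conjecture for every product `⨁_{j<M} A_{π j}` — every `E^a × S^b × T^c` — of an elliptic curve `E`
with CM by `ℤ[ζ₃]`, an abelian surface `S` with CM by `ℤ[ζ₅]` and a SIMPLE abelian threefold `T` with CM by `ℤ[ζ₇]`,
for EVERY choice of the three CM types**, UNCONDITIONAL. (If `T` is not simple the family is degenerate: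
`isNondegenerateFamily_iff_isSimple_seven`.) [cite: Gordon1999HodgeAVSurvey, §3 Theorem and 10.10]
[cite: Ribet1980, §3 Examples (3.7) (p. 87)] -/
theorem hodgeConjectureFor_prod_of_isSimple (hA : ∀ i, IsCMTypeRealisation (Ψ i) (A i) (ι i) (θ i))
    (hT : (A .seven).IsSimple) {M : ℕ} (π : Fin M → Slot) :
    HodgeConjectureFor (⨁ fun j : Fin M => A (π j)).dim (⨁ fun j : Fin M => A (π j)).X := by
  haveI : ∀ i, IsCMField (K i) := isCMField_K K
  exact hodgeConjectureFor_prod_of_coprime_cyclotomic level level_coprime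
    ((isNondegenerateFamily_iff_of_coprime_cyclotomic level level_coprime Ψ).1
      ((isNondegenerateFamily_iff_isSimple_seven hA).2 hT)) hA π

/-- The same with the hypothesis on the TYPE: `Ψ_7` primitive (at any base embedding).
[cite: Gordon1999HodgeAVSurvey, §3 Theorem and 10.10] [cite: Shimura1998, §8.2 Prop. 26] -/
theorem hodgeConjectureFor_prod_of_isPrimitive_seven (hA : ∀ i, IsCMTypeRealisation (Ψ i) (A i) (ι i) (θ i))
    (φ₀ : K .seven →+* ℂ) (h7 : IsPrimitive (ℂ ≃+* ℂ) (Ψ .seven).1 φ₀) {M : ℕ} (π : Fin M → Slot) :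
    HodgeConjectureFor (⨁ fun j : Fin M => A (π j)).dim (⨁ fun j : Fin M => A (π j)).X :=
  hodgeConjectureFor_prod_of_isSimple hA ((isSimple_iff_isPrimitive (hA .seven) φ₀).2 h7) π

open scoped Function in
/-- **The Hodge conjecture for every `E^a × S^b` — every product `⨁_{j<M} A_{π j}` avoiding the `ℚ(ζ₇)`-slot — of an
elliptic curve with CM by `ℤ[ζ₃]` and an abelian surface with CM by `ℤ[ζ₅]`, with NO hypothesis on the CM types or on
the varieties** (the sub-family `(Ψ_3, Ψ_5)` is always nondegenerate). [cite: Gordon1999HodgeAVSurvey, §3 Theorem and 10.10]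
[cite: Ribet1980, §3 Examples (3.7) (p. 87)] -/
theorem hodgeConjectureFor_prod_of_forall_ne_seven (hA : ∀ i, IsCMTypeRealisation (Ψ i) (A i) (ι i) (θ i))
    {M : ℕ} (π : Fin M → Slot) (hπ : ∀ j, π j ≠ .seven) :
    HodgeConjectureFor (⨁ fun j : Fin M => A (π j)).dim (⨁ fun j : Fin M => A (π j)).X := by
  haveI : ∀ i : {i : Slot // i ≠ .seven}, IsCMField (K i.1) := fun i => isCMField_K K i.1
  haveI : Nonempty {i : Slot // i ≠ .seven} := ⟨⟨.three, by decide⟩⟩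
  have hcop : Pairwise (Nat.Coprime on fun i : {i : Slot // i ≠ .seven} => level i.1) :=
    fun i j hij => level_coprime fun h => hij (Subtype.ext h)
  exact hodgeConjectureFor_prod_of_coprime_cyclotomic (I := {i : Slot // i ≠ .seven}) (K := fun i => K i.1)
    (Φ := fun i => Ψ i.1) (A := fun i => A i.1) (ι := fun i => ι i.1) (θ := fun i => θ i.1)
    (fun i => level i.1) hcop (fun i => isNondegenerate_of_ne_seven K i.2 (Ψ i.1)) (fun i => hA i.1)
    (fun j => ⟨π j, hπ j⟩)

open scoped Function in
/-- `Bᵐ ⊗ ℂ = Dᵐ ⊗ ℂ` on every `E^a × S^b` as above, no hypothesis. [cite: Gordon1999HodgeAVSurvey, §3 Theorem (2) and 7.5] -/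
theorem hodgeClassSpan_prod_eq_divisorClassesSpan_of_forall_ne_seven
    (hA : ∀ i, IsCMTypeRealisation (Ψ i) (A i) (ι i) (θ i)) {M : ℕ} (π : Fin M → Slot) (hπ : ∀ j, π j ≠ .seven)
    (m : ℕ) :
    hodgeClassSpan (⨁ fun j : Fin M => A (π j)).dim (⨁ fun j : Fin M => A (π j)).X m =
      divisorClassesSpan (⨁ fun j : Fin M => A (π j)).X (⨁ fun j : Fin M => A (π j)).dim m := by
  haveI : ∀ i : {i : Slot // i ≠ .seven}, IsCMField (K i.1) := fun i => isCMField_K K i.1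
  haveI : Nonempty {i : Slot // i ≠ .seven} := ⟨⟨.three, by decide⟩⟩
  have hcop : Pairwise (Nat.Coprime on fun i : {i : Slot // i ≠ .seven} => level i.1) :=
    fun i j hij => level_coprime fun h => hij (Subtype.ext h)
  exact hodgeClassSpan_prod_eq_divisorClassesSpan_of_coprime_cyclotomic (I := {i : Slot // i ≠ .seven})
    (K := fun i => K i.1) (Φ := fun i => Ψ i.1) (A := fun i => A i.1) (ι := fun i => ι i.1)
    (θ := fun i => θ i.1) (fun i => level i.1) hcop (fun i => isNondegenerate_of_ne_seven K i.2 (Ψ i.1))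
    (fun i => hA i.1) (fun j => ⟨π j, hπ j⟩) m

/-- **Existence form, all types**: for EVERY choice of CM types `Ψ_3, Ψ_5, Ψ_7` with `Ψ_7` primitive there are an
elliptic curve, an abelian surface and an abelian threefold of these types (Shimura §6.2 Thm. 3, tree theorem
`cmAbelianVarietyRealised_holds`), all simple, all of whose products of powers satisfy the Hodge conjecture.
[cite: Shimura1998, §6.2 Theorem 3] [cite: Gordon1999HodgeAVSurvey, 10.10] -/
theorem exists_realisations_hodgeConjecture_products (φ₀ : K .seven →+* ℂ)
    (h7 : IsPrimitive (ℂ ≃+* ℂ) (Ψ .seven).1 φ₀) :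
    ∃ (X : Slot → AbelianVariety ℂ) (ι : ∀ i, 𝓞 (K i) →+* End (X i))
      (θ : ∀ i, K i →+* Module.End ℂ (complexBetti (X i).X 1)),
      (∀ i, IsCMTypeRealisation (Ψ i) (X i) (ι i) (θ i)) ∧
      (X .three).dim = 1 ∧ (X .five).dim = 2 ∧ (X .seven).dim = 3 ∧ (∀ i, (X i).IsSimple) ∧
      ∀ (M : ℕ) (π : Fin M → Slot),
        HodgeConjectureFor (⨁ fun j : Fin M => X (π j)).dim (⨁ fun j : Fin M => X (π j)).X := by
  haveI : ∀ i, IsCMField (K i) := isCMField_K K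
  choose X ι θ hX using fun i : Slot => cmAbelianVarietyRealised_holds (K i) (Ψ i)
  have hX' : ∀ i, IsCMTypeRealisation (Ψ i) (X i) (ι i) (θ i) := fun i => hX i
  have hT : (X .seven).IsSimple := (isSimple_iff_isPrimitive (hX' .seven) φ₀).2 h7
  obtain ⟨h3, h5, h7'⟩ := dim_eq hX'
  refine ⟨X, ι, θ, hX', h3, h5, h7', fun i => ?_, fun M π => hodgeConjectureFor_prod_of_isSimple hX' hT π⟩
  by_cases hi : i = .seven
  · subst hi; exact hT
  · exact isSimple_of_ne_seven hi (hX' i)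

end Census

end AllTypes

end Summit.HodgeConjecture.CorCM.Census.CoprimeCyclotomicProducts357

end
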